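import Summits.HodgeConjecture.HodgeConjecture.Theorems.F0P3KitOfRecord   -- ★ K0 (F0P3-p04 (g7)): `kitOfRecord`, `GHSide`, `XiSide`, `cptXi₀`, the `rfl` read-backs
import HarnessLib

/-!
# Crux `H413` — closer ED. 38 «PK-ε», ★1 K0-W: **the classification kit of record WITH THE ROOT-NUMBER SIGN, `kitOfRecordW`**

F0∕P3 «U3-mult», cell `hodgecm-mathlib`, crux H413 (`stmt-HodgeConjecture-24833`); RULING D53-pre (desk heir F0P3-plan (g12), `F0/P3/F0P3-plan/g12/ed38/RULING-D53pre…md`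
f17dc03034ce6b66) PART A (3)∕(4) ★1; LEAD F0P3a-plan (g12) T11-64∕T11-66 (variant 2)∕T11-69; P3b desk memo b086a430ac19212c §2–§3; ref1 (g12) OBJ-3 (root number);
pen F0P3a-p02 (g15) (K0 lineage F0P3-p04).  THEOREMS-SIDE, ADDITIVE: K0 ★ `kitOfRecord` is untouched and every ★ fact about it stays importable.

THE MATHEMATICS (Rogawski 1990 Thm. 14.6.4 as corrected by Rogawski 1992 Thm. 1.2).  In the multiplicity formula for the endoscopic packets `Π(ξ)` the STABLE
(`G′`-side, signed) summand carries the global root number `W(ξ) = ε(½, φ_ξ) ∈ {±1}`, `φ_ξ := μω·(χ₁ξ)_L`:  `m(π) = ½·(1 + W(ξ)·(−1)^{n(π)+N})` (Rogawski 1992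
Thm. 1.2; the 1990 text is the case `W ≡ 1`).  In the kit currency of ★ V6 (`ClassificationKit.expansion ξ S x = [cptXi ξ]·½·(−1)^{N ξ}·(∏(−1)-coeffs + sgnG ξ·∏(+1)-coeffs)`)
the per-ξ sign is carried — with NO change to any ★ V6∕V8 definition or law — by making the two sign fields per-ξ (RULING D53-pre (3), forced by the linear independence
of the member characters):
  `N    := fun ξ => nCompactOfRecord L + (if wXi ξ = -1 then 1 else 0)`,   `sgnG := fun ξ => (wXi ξ : ℚ) * c`,
so that `expansion = ½[cpt]·((−1)^{n+N₀}·W + (−1)^{N₀}·c)·W… = ½[cpt](1 + W(ξ)(−1)^{n(x)+N₀})` once `(−1)^{N₀} c = 1` ((k), unchanged), and `|sgnG ξ| = 1` still.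
THIS FILE: `kitOfRecordW … μω wXi c …` = `{ kitOfRecord … μω c … with N := …, sgnG := … }` (structure update: every sign-blind projection is DEFINITIONALLY
`kitOfRecord`'s), its `rfl` read-backs (K0 §4 twins + `kitOfRecordW_N`∕`kitOfRecordW_sgnG`), `kitOfRecordW_one` (`wXi ≡ 1` gives back `kitOfRecord`), and the sign law
`kitOfRecordW_sgnG_eq_one_or_eq_neg_one`.  No `sorry`, no named fact, no instance, no notation; `--supports stmt-HodgeConjecture-24833`.
HONEST LABEL: HC_CM is proved only modulo the printed citations until rung 0 closes; this file is count-neutral support (it re-threads the sign of row #181 «PK-tuple»).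

References: [Rogawski1990] §14.6 Thm. 14.6.4 pp. 236–244, §13.7 p. 206; [Rogawski1992] J. D. Rogawski, *The multiplicity formula for A-packets*, in: The zeta
functions of Picard modular surfaces (CRM, 1992) 395–419, Thm. 1.2 p. 397, §6 p. 417; [GerbelliGauthier2019] Thm. 22, Thm. 24, Rem. 23, Rem. 25.
-/

set_option autoImplicit false
-- the mandated namespace repeats `HodgeConjecture.HodgeConjecture`, as in every `Theorems/*.lean` of this sub-problem
set_option linter.dupNamespace false

noncomputable section

open NumberField IsDedekindDomain MeasureTheory
open Literature.NumberTheory.Rogawski1990 Literature.NumberTheory.GaloisRepresentations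
open Literature.NumberTheory.Automorphic Literature.NumberTheory.Automorphic.UnitaryGroup
open Literature.NumberTheory.Automorphic.UnitaryGroup.CotangentForms
open scoped Matrix

namespace Summit.HodgeConjecture.HodgeConjecture.Cruxes.H413.F0P3KitOfRecordW

open Summit.HodgeConjecture.HodgeConjecture.Cruxes.H413.F0P3InnerFormClassificationV6
open Summit.HodgeConjecture.HodgeConjecture.Cruxes.H413.F0P3ClassTokensOfRecord (Cls cl rep mult)
open Summit.HodgeConjecture.HodgeConjecture.Cruxes.H413.F0P3ClassTokenChoice (clFinChoice evpChoice)
open Summit.HodgeConjecture.HodgeConjecture.Cruxes.H413.F0P3CompactTrivOfRecord (cptTriv₀)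
open Summit.HodgeConjecture.HodgeConjecture.Cruxes.H413.F0P3UnitaryLocOfRecord (clInfChoiceU unitaryLoc₀)
open Summit.HodgeConjecture.HodgeConjecture.Cruxes.H413.F0P3TestFunctionsOfRecord (Unr₀ hat₀)
open Summit.HodgeConjecture.HodgeConjecture.Cruxes.H413.F0P3SpectralSideOfRecord (trGp₀)
open Summit.HodgeConjecture.HodgeConjecture.Cruxes.H413.F0P3SemilocalTestFunctionsOfRecord (TestS₀ tens₀ chS₀)
open Summit.HodgeConjecture.HodgeConjecture.Cruxes.H413.F0P3XiArchDataOfRecord (nCompactOfRecord sgnInfOfRecord archTypeOfRecord)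
open Summit.HodgeConjecture.HodgeConjecture.Cruxes.H413.F0P3XiArchPacketOfRecord (archPacketOfRecord)
open Summit.HodgeConjecture.HodgeConjecture.Cruxes.H413.F0P3bArchDegOneClass (archDegOneClass)
open Summit.HodgeConjecture.HodgeConjecture.Cruxes.H413.F0P3KitOfRecord (GHSide XiSide cptXi₀ kitOfRecord)

variable (L : Type) [Field L] [NumberField L] [IsCMField L] (H : Matrix (Fin 3) (Fin 3) L) (ι : L →+* ℂ) (T : GL (Fin 3) ℂ)
  (hT : (T : Matrix (Fin 3) (Fin 3) ℂ)ᴴ * H.map ι * (T : Matrix (Fin 3) (Fin 3) ℂ) = Literature.Geometry.ComplexHyperbolic.BallModel.J)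
variable (μ : Measure (Gp L H).automorphicQuotient) [(Gp L H).IsAutomorphicMeasure μ]
  [MeasurableSpace (Gp L H).Adelic] [BorelSpace (Gp L H).Adelic]

/-! ## §1 THE KIT OF RECORD WITH THE ROOT-NUMBER SIGN `𝔠₀^W = kitOfRecordW …` -/

/-- **`kitOfRecordW` — THE CLASSIFICATION KIT OF RECORD WITH THE PER-ξ ROOT-NUMBER SIGN `wXi`** (RULING D53-pre (3)∕(4) ★1): the parameter list of ★ `kitOfRecord`
with `(wXi : OneDimAutRepH L → ℤ)` inserted IMMEDIATELY BEFORE `(c : ℚ)`, body the structure update of `kitOfRecord … c …` at the two sign fields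
`N := fun ξ => nCompactOfRecord L + (if wXi ξ = -1 then 1 else 0)` and `sgnG := fun ξ => (wXi ξ : ℚ) * c` — so `expansion` reads `½[cpt](1 + wXi ξ·(−1)^{n(x)+N₀})`
(Rogawski 1992 Thm. 1.2) once `(−1)^{N₀} c = 1`, and every other field is `kitOfRecord`'s by `rfl`.
[cite: Rogawski1990, §14.6 Thm. 14.6.4 pp. 236–244; §13.7 p. 206] [cite: Rogawski1992, Thm. 1.2 p. 397; §6 p. 417] -/
def kitOfRecordW (𝔰 : Sockets L H μ) (gh : GHSide L H ι T hT 𝔰.PacketG 𝔰.PacketH) (ξd : XiSide L H 𝔰.PacketG 𝔰.PacketH)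
    (μω : HeckeCharacter L) (wXi : OneDimAutRepH L → ℤ) (c : ℚ) (jInf dsInf : ℤ → ℤ → ℤ → Cinf)
    (archTr : Cinf → (UnitaryGroup.arch (↥(maximalRealSubfield L)) L (IsCMField.complexConj L) 3 H → ℂ) → ℂ)
    (ν : Measure (Gp L H).Adelic) [IsFiniteMeasureOnCompacts ν]
    (μv : ∀ v : Places L, @Measure ((cmDatum L 3 H).Local v) (borel _))
    (ramCls₀ : DiscreteAutomorphicRep (Gp L H) μ → Set (Places L)) :
    ClassificationKit L H ι T hT μ :=
  { kitOfRecord L H ι T hT μ 𝔰 gh ξd μω c jInf dsInf archTr ν μv ramCls₀ with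
    N := fun ξ => nCompactOfRecord L + (if wXi ξ = -1 then 1 else 0)
    sgnG := fun ξ => (wXi ξ : ℚ) * c }

/-! ## §2 Read-backs (`rfl`) — the fields of `𝔠₀^W` BY NAME: the two sign fields, and every sign-blind field = `kitOfRecord`'s -/

section ReadBacks

variable (𝔰 : Sockets L H μ) (gh : GHSide L H ι T hT 𝔰.PacketG 𝔰.PacketH) (ξd : XiSide L H 𝔰.PacketG 𝔰.PacketH)
  (μω : HeckeCharacter L) (wXi : OneDimAutRepH L → ℤ) (c : ℚ) (jInf dsInf : ℤ → ℤ → ℤ → Cinf)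
  (archTr : Cinf → (UnitaryGroup.arch (↥(maximalRealSubfield L)) L (IsCMField.complexConj L) 3 H → ℂ) → ℂ)
  (ν : Measure (Gp L H).Adelic) [IsFiniteMeasureOnCompacts ν]
  (μv : ∀ v : Places L, @Measure ((cmDatum L 3 H).Local v) (borel _))
  (ramCls₀ : DiscreteAutomorphicRep (Gp L H) μ → Set (Places L))

/-- `𝔠₀^W.N ξ = nCompactOfRecord L + [wXi ξ = −1]` (the per-ξ parity shift of the root number). [cite: Rogawski1992, Thm. 1.2 p. 397] -/
theorem kitOfRecordW_N (ξ : OneDimAutRepH L) :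
    (kitOfRecordW L H ι T hT μ 𝔰 gh ξd μω wXi c jInf dsInf archTr ν μv ramCls₀).N ξ = nCompactOfRecord L + (if wXi ξ = -1 then 1 else 0) := rfl
/-- `𝔠₀^W.sgnG ξ = wXi ξ · c`. [cite: Rogawski1992, Thm. 1.2 p. 397] -/
theorem kitOfRecordW_sgnG (ξ : OneDimAutRepH L) :
    (kitOfRecordW L H ι T hT μ 𝔰 gh ξd μω wXi c jInf dsInf archTr ν μv ramCls₀).sgnG ξ = (wXi ξ : ℚ) * c := rfl
/-- The SIGNED-side law survives: `𝔠₀^W.sgnG ξ = 1 ∨ 𝔠₀^W.sgnG ξ = −1` when `wXi ξ = ±1` and `c = ±1` (so ★ V6 `abs_expansion_le` still applies).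
[cite: Rogawski1992, Thm. 1.2 p. 397] -/
theorem kitOfRecordW_sgnG_eq_one_or_eq_neg_one (hw : ∀ ξ, wXi ξ = 1 ∨ wXi ξ = -1) (hc : c = 1 ∨ c = -1) (ξ : OneDimAutRepH L) :
    (kitOfRecordW L H ι T hT μ 𝔰 gh ξd μω wXi c jInf dsInf archTr ν μv ramCls₀).sgnG ξ = 1 ∨
      (kitOfRecordW L H ι T hT μ 𝔰 gh ξd μω wXi c jInf dsInf archTr ν μv ramCls₀).sgnG ξ = -1 := by
  rw [kitOfRecordW_sgnG]
  rcases hw ξ with h | h <;> rcases hc with h' | h' <;> simp [h, h']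
/-- `𝔠₀^W.N ξ = nCompactOfRecord L` where the root number is `+1`. [cite: Rogawski1992, Thm. 1.2 p. 397] -/
theorem kitOfRecordW_N_of_eq_one {ξ : OneDimAutRepH L} (h : wXi ξ = 1) :
    (kitOfRecordW L H ι T hT μ 𝔰 gh ξd μω wXi c jInf dsInf archTr ν μv ramCls₀).N ξ = nCompactOfRecord L := by
  rw [kitOfRecordW_N, h]; simp
/-- `𝔠₀^W.N ξ = nCompactOfRecord L + 1` where the root number is `−1`. [cite: Rogawski1992, Thm. 1.2 p. 397] -/
theorem kitOfRecordW_N_of_eq_neg_one {ξ : OneDimAutRepH L} (h : wXi ξ = -1) :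
    (kitOfRecordW L H ι T hT μ 𝔰 gh ξd μω wXi c jInf dsInf archTr ν μv ramCls₀).N ξ = nCompactOfRecord L + 1 := by
  rw [kitOfRecordW_N, h]; simp

/-- `𝔠₀^W` at the trivial root-number sign `wXi ≡ 1` IS `𝔠₀` (so every ED. ≤ 37 kit fact is the special case). [cite: Rogawski1990, §14.6 Thm. 14.6.4 p. 244] -/
theorem kitOfRecordW_one :
    kitOfRecordW L H ι T hT μ 𝔰 gh ξd μω (fun _ => 1) c jInf dsInf archTr ν μv ramCls₀ =
      kitOfRecord L H ι T hT μ 𝔰 gh ξd μω c jInf dsInf archTr ν μv ramCls₀ := by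
  have h1 : (fun ξ : OneDimAutRepH L => nCompactOfRecord L + (if ((fun _ : OneDimAutRepH L => (1 : ℤ)) ξ) = -1 then 1 else 0)) =
      fun _ => nCompactOfRecord L := by
    funext ξ; simp
  have h2 : (fun ξ : OneDimAutRepH L => (((fun _ : OneDimAutRepH L => (1 : ℤ)) ξ : ℤ) : ℚ) * c) = fun _ => c := by
    funext ξ; simp
  unfold kitOfRecordW
  rw [h1, h2]
  rfl

/-- `𝔠₀^W.Cls = Cls (Gp L H) μ`. -/
theorem kitOfRecordW_Cls : (kitOfRecordW L H ι T hT μ 𝔰 gh ξd μω wXi c jInf dsInf archTr ν μv ramCls₀).Cls = Cls (Gp L H) μ := rfl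
/-- `𝔠₀^W.cl = cl`. -/
theorem kitOfRecordW_cl (P : DiscreteAutomorphicRep (Gp L H) μ) :
    (kitOfRecordW L H ι T hT μ 𝔰 gh ξd μω wXi c jInf dsInf archTr ν μv ramCls₀).cl P = cl (Gp L H) μ P := rfl
/-- `𝔠₀^W.mult = mult`. -/
theorem kitOfRecordW_mult (x : Cls (Gp L H) μ) :
    (kitOfRecordW L H ι T hT μ 𝔰 gh ξd μω wXi c jInf dsInf archTr ν μv ramCls₀).mult x = mult (Gp L H) μ x := rfl
/-- `𝔠₀^W.ramCls x = ramCls₀ (rep x)`. -/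
theorem kitOfRecordW_ramCls (x : Cls (Gp L H) μ) :
    (kitOfRecordW L H ι T hT μ 𝔰 gh ξd μω wXi c jInf dsInf archTr ν μv ramCls₀).ramCls x = ramCls₀ (rep (Gp L H) μ x) := rfl
/-- `𝔠₀^W.evp x v = evpChoice (rep x) v (μv v)`. -/
theorem kitOfRecordW_evp (x : Cls (Gp L H) μ) (v : Places L) :
    (kitOfRecordW L H ι T hT μ 𝔰 gh ξd μω wXi c jInf dsInf archTr ν μv ramCls₀).evp x v = evpChoice (rep (Gp L H) μ x) v (μv v) := rfl
/-- `𝔠₀^W.cptTriv = cptTriv₀`. -/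
theorem kitOfRecordW_cptTriv (x : Cls (Gp L H) μ) :
    (kitOfRecordW L H ι T hT μ 𝔰 gh ξd μω wXi c jInf dsInf archTr ν μv ramCls₀).cptTriv x = cptTriv₀ L ι H T hT μ x := rfl
/-- `𝔠₀^W.clFin x v = clFinChoice (rep x) v`. -/
theorem kitOfRecordW_clFin (x : Cls (Gp L H) μ) (v : Places L) :
    (kitOfRecordW L H ι T hT μ 𝔰 gh ξd μω wXi c jInf dsInf archTr ν μv ramCls₀).clFin x v = clFinChoice (rep (Gp L H) μ x) v := rfl
/-- `𝔠₀^W.clInf x = clInfChoiceU [J⁺] (rep x)`. -/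
theorem kitOfRecordW_clInf (x : Cls (Gp L H) μ) :
    (kitOfRecordW L H ι T hT μ 𝔰 gh ξd μω wXi c jInf dsInf archTr ν μv ramCls₀).clInf x =
      clInfChoiceU L H ι T hT μ (archDegOneClass 1 (Or.inl rfl)) (rep (Gp L H) μ x) := rfl
/-- `𝔠₀^W.UnitaryLoc = unitaryLoc₀`. -/
theorem kitOfRecordW_UnitaryLoc (S : Finset (Places L)) (x : LocS L H S) :
    (kitOfRecordW L H ι T hT μ 𝔰 gh ξd μω wXi c jInf dsInf archTr ν μv ramCls₀).UnitaryLoc S x = unitaryLoc₀ L H S x := rfl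
/-- `𝔠₀^W.coordS S x = (clInfChoiceU [J⁺] (rep x), fun v => clFinChoice (rep x) v)`. -/
theorem kitOfRecordW_coordS (S : Finset (Places L)) (x : Cls (Gp L H) μ) :
    (kitOfRecordW L H ι T hT μ 𝔰 gh ξd μω wXi c jInf dsInf archTr ν μv ramCls₀).coordS S x =
      (clInfChoiceU L H ι T hT μ (archDegOneClass 1 (Or.inl rfl)) (rep (Gp L H) μ x), fun v : ↥S => clFinChoice (rep (Gp L H) μ x) v.1) := rfl
/-- `𝔠₀^W.hat = hat₀`. -/
theorem kitOfRecordW_hat (S : Finset (Places L)) (g : Germ L H S) (F : Unr₀ L H S) :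
    (kitOfRecordW L H ι T hT μ 𝔰 gh ξd μω wXi c jInf dsInf archTr ν μv ramCls₀).hat S g F = hat₀ L H S g F := rfl
/-- `𝔠₀^W.tens = tens₀`. -/
theorem kitOfRecordW_tens (S : Finset (Places L)) (fS : TestS₀ L H ι T hT S) (fT : Unr₀ L H S) :
    (kitOfRecordW L H ι T hT μ 𝔰 gh ξd μω wXi c jInf dsInf archTr ν μv ramCls₀).tens S fS fT = tens₀ S fS fT := rfl
/-- `𝔠₀^W.trGp = trGp₀`. -/
theorem kitOfRecordW_trGp (x : Cls (Gp L H) μ) (F : TestGp L H) :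
    (kitOfRecordW L H ι T hT μ 𝔰 gh ξd μω wXi c jInf dsInf archTr ν μv ramCls₀).trGp x F = trGp₀ (Gp L H) μ ν x F := rfl
/-- `𝔠₀^W.chS = chS₀ archTr μv`. -/
theorem kitOfRecordW_chS (S : Finset (Places L)) (x : LocS L H S) (fS : TestS₀ L H ι T hT S) :
    (kitOfRecordW L H ι T hT μ 𝔰 gh ξd μω wXi c jInf dsInf archTr ν μv ramCls₀).chS S x fS = chS₀ archTr μv S x fS := rfl
/-- `𝔠₀^W.packInf = archPacketOfRecord ι μω jInf dsInf`. -/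
theorem kitOfRecordW_packInf (ξ : OneDimAutRepH L) :
    (kitOfRecordW L H ι T hT μ 𝔰 gh ξd μω wXi c jInf dsInf archTr ν μv ramCls₀).packInf ξ = archPacketOfRecord ι μω jInf dsInf ξ := rfl
/-- `𝔠₀^W.cptXi = cptXi₀ ι μω`. -/
theorem kitOfRecordW_cptXi (ξ : OneDimAutRepH L) :
    (kitOfRecordW L H ι T hT μ 𝔰 gh ξd μω wXi c jInf dsInf archTr ν μv ramCls₀).cptXi ξ = cptXi₀ ι μω ξ := rfl
/-- `𝔠₀^W.sgnInf = sgnInfOfRecord ι μω`. -/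
theorem kitOfRecordW_sgnInf (ξ : OneDimAutRepH L) :
    (kitOfRecordW L H ι T hT μ 𝔰 gh ξd μω wXi c jInf dsInf archTr ν μv ramCls₀).sgnInf ξ = sgnInfOfRecord ι μω ξ := rfl
/-- `𝔠₀^W.traceGp = 𝔰.traceGp` (T1's socket, untouched). -/
theorem kitOfRecordW_traceGp : (kitOfRecordW L H ι T hT μ 𝔰 gh ξd μω wXi c jInf dsInf archTr ν μv ramCls₀).traceGp = 𝔰.traceGp := rfl
/-- `𝔠₀^W.toSockets = 𝔰` (all nine T1 sockets untouched). -/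
theorem kitOfRecordW_toSockets : (kitOfRecordW L H ι T hT μ 𝔰 gh ξd μω wXi c jInf dsInf archTr ν μv ramCls₀).toSockets = 𝔰 := rfl

/-! ### §2.1 The sign-blind fields agree with `𝔠₀`'s DEFINITIONALLY (for re-using every `…_kitOfRecord…` ★ fact) -/

/-- `𝔠₀^W.evp = 𝔠₀.evp`. -/
theorem kitOfRecordW_evp_eq : (kitOfRecordW L H ι T hT μ 𝔰 gh ξd μω wXi c jInf dsInf archTr ν μv ramCls₀).evp =
    (kitOfRecord L H ι T hT μ 𝔰 gh ξd μω c jInf dsInf archTr ν μv ramCls₀).evp := rfl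
/-- `𝔠₀^W.cptXi = 𝔠₀.cptXi`. -/
theorem kitOfRecordW_cptXi_eq : (kitOfRecordW L H ι T hT μ 𝔰 gh ξd μω wXi c jInf dsInf archTr ν μv ramCls₀).cptXi =
    (kitOfRecord L H ι T hT μ 𝔰 gh ξd μω c jInf dsInf archTr ν μv ramCls₀).cptXi := rfl
/-- `𝔠₀^W.packInf = 𝔠₀.packInf`. -/
theorem kitOfRecordW_packInf_eq : (kitOfRecordW L H ι T hT μ 𝔰 gh ξd μω wXi c jInf dsInf archTr ν μv ramCls₀).packInf =
    (kitOfRecord L H ι T hT μ 𝔰 gh ξd μω c jInf dsInf archTr ν μv ramCls₀).packInf := rfl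
/-- `𝔠₀^W.packFin = 𝔠₀.packFin`. -/
theorem kitOfRecordW_packFin_eq : (kitOfRecordW L H ι T hT μ 𝔰 gh ξd μω wXi c jInf dsInf archTr ν μv ramCls₀).packFin =
    (kitOfRecord L H ι T hT μ 𝔰 gh ξd μω c jInf dsInf archTr ν μv ramCls₀).packFin := rfl
/-- `𝔠₀^W.sgnInf = 𝔠₀.sgnInf`. -/
theorem kitOfRecordW_sgnInf_eq : (kitOfRecordW L H ι T hT μ 𝔰 gh ξd μω wXi c jInf dsInf archTr ν μv ramCls₀).sgnInf =
    (kitOfRecord L H ι T hT μ 𝔰 gh ξd μω c jInf dsInf archTr ν μv ramCls₀).sgnInf := rfl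
/-- `𝔠₀^W.PiXi = 𝔠₀.PiXi`. -/
theorem kitOfRecordW_PiXi_eq : (kitOfRecordW L H ι T hT μ 𝔰 gh ξd μω wXi c jInf dsInf archTr ν μv ramCls₀).PiXi =
    (kitOfRecord L H ι T hT μ 𝔰 gh ξd μω c jInf dsInf archTr ν μv ramCls₀).PiXi := rfl
/-- `𝔠₀^W.ρXi = 𝔠₀.ρXi`. -/
theorem kitOfRecordW_ρXi_eq : (kitOfRecordW L H ι T hT μ 𝔰 gh ξd μω wXi c jInf dsInf archTr ν μv ramCls₀).ρXi =
    (kitOfRecord L H ι T hT μ 𝔰 gh ξd μω c jInf dsInf archTr ν μv ramCls₀).ρXi := rfl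
/-- `𝔠₀^W.tXi = 𝔠₀.tXi`. -/
theorem kitOfRecordW_tXi_eq : (kitOfRecordW L H ι T hT μ 𝔰 gh ξd μω wXi c jInf dsInf archTr ν μv ramCls₀).tXi =
    (kitOfRecord L H ι T hT μ 𝔰 gh ξd μω c jInf dsInf archTr ν μv ramCls₀).tXi := rfl
/-- `𝔠₀^W.ram = 𝔠₀.ram`. -/
theorem kitOfRecordW_ram_eq : (kitOfRecordW L H ι T hT μ 𝔰 gh ξd μω wXi c jInf dsInf archTr ν μv ramCls₀).ram =
    (kitOfRecord L H ι T hT μ 𝔰 gh ξd μω c jInf dsInf archTr ν μv ramCls₀).ram := rfl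

end ReadBacks

end Summit.HodgeConjecture.HodgeConjecture.Cruxes.H413.F0P3KitOfRecordW

end
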